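import Summits.HodgeConjecture.HodgeConjecture.Theorems.F0P3cStCharTSClassFn   -- ★ (LH6-p04) «CLASS-FN★» `isClassFunOn_of_locallyConstant_of_smoothTrace` + the `U(Φ₃)(L⁺_v)` instances∕admissibility it imports
import Literature.NumberTheory.Rogawski1990.Ch12Sec5                          -- ★ CARPET `EllipticData.WeylIntegrationFormula` [§12.5 p. 182]
import Literature.NumberTheory.Rogawski1990.Ch12Sec6                          -- ★ CARPET `Ch12Sec6.PseudoCoeffTrace` [§12.6 p. 187] (the target)
import HarnessLib

/-!
# F0 · P3c · line LH6 «StCharTS» — «PCT-OUT★»: the carpet relation «`Tr(π′(f_π)) = ⟨χ_{π′}, χ_π⟩_e`» (★ `Ch12Sec6.PseudoCoeffTrace`) DERIVED, as print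
# derives it — «By the Weyl integration formula» [Rogawski1990, §12.6 p. 187] — from the (S-𝔇) package with (M1) read for EVERY class (datum road, slice 3)

Cell `pub/hodgecm-mathlib`, crux H413 = `stmt-HodgeConjecture-24833` (lane `--supports …`), route HCCMUnconditional; seat LH6-p01 (g4).
THEOREMS ONLY (no definition ∕ instance ∕ notation ∕ named fact ∕ `sorry`); ★-only imports.

WHAT.  In the (S-𝔇) organ `stub_EllipticPackage` of `Cruxes/H413/Lines/F0_P3c_StCharTSPaydown.lean` the relation ★ `Ch12Sec6.PseudoCoeffTrace 𝔇` («for every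
`π′ ∈ E(G)` and every pseudo-coefficient `f_π` of `π`, `Tr π′(f_π) = ⟨χ_{π′}, χ_π⟩_e`», p. 187) is carried as a CARPET conjunct.  Print proves it in one
clause — «By the Weyl integration formula» — and so does this file, from conjuncts the package already carries: the carpet ★ `WeylIntegrationFormula`
(p. 182), the sockets (C1) `EllCartanSubset`, (C2) `EllCartanAE`, (C3) `NonEllCartanAE`, (L2D∀) `L2CharOnTorusAll`, and the character socket (M1) READ
FOR EVERY CLASS `π′` (the trace side of the identity is an ARBITRARY class; §1.6 p. 5 states Harish-Chandra's theorem for every admissible `π`, and ★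
«CHAR-FIELD★» `F0P3cStCharTSCharField` (p851211) pays exactly this ∀-form at the concrete datum from the named fact ★ `Ch1.characterLocallyIntegrable`):
`Tr π′(f) = ∫_G f χ_{π′}` [(M1) at `π′`] `= Σ_{T ∈ 𝒞_all} |Ω_T|⁻¹ ∫_T D² Φ(·, f) χ_{π′}` [WIF, `χ_{π′}` a class function on `G^r` by ★ «CLASS-FN★»] `=
Σ_{T ∈ 𝒞_G} |Ω_T|⁻¹ ∫_T D² \overline{χ_π} χ_{π′} + 0` [(C1): split the sum; (C3): on a non-elliptic `T` a.e. `Φ(t, f) = 0`; (C2): on an elliptic `T` a.e.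
`Φ(t, f) = \overline{χ_π(t)}`] `= ⟨χ_{π′}, χ_π⟩_e` [definition, p. 184]; the convergence hypotheses of WIF are discharged by `f ∈ C_c^∞` + local
integrability of `χ_{π′}` (on `G`) and by (L2D∀) + Cauchy–Schwarz (on the elliptic tori).
* §1 generic carriers: `pseudoCoeffTrace_of_weylIntegrationFormula` (class-function property of the characters as a hypothesis);
* §2 `U(Φ₃)(L⁺_v)`, non-split `v`: `pseudoCoeffTrace_Gqs` — the class-function hypothesis discharged by ★ «CLASS-FN★» (every class of `U(Φ₃)(L⁺_v)` is
  admissible, ★ `isAdmissible_irrClass_quasiSplit_of_cuspidal`), leaving exactly: COMPAT (`μG`, `regG`), (M1∀), WIF, (C1), (C2), (C3), (L2D∀).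
LEAF EFFECT (optional, the pen's ∕ desk's call; count-neutral): read (M1) for every class (print's own scope) and DROP the carpet conjunct
`Ch12Sec6.PseudoCoeffTrace 𝔇 ∧`, feeding `hPCT := pseudoCoeffTrace_Gqs …` at the consumers.
HONEST LABEL: HC_CM is proved only modulo the 7 printed citations (2 remaining named inputs: hLiu418 = `stmt-HodgeConjecture-24832`, h413 =
`stmt-HodgeConjecture-24833`) until rung 0 closes; this file closes no organ.

## References
* [Rogawski1990] J. D. Rogawski, *Automorphic Representations of Unitary Groups in Three Variables*, Ann. of Math. Stud. 123 (1990): §1.6 p. 5; §12.5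
  p. 182 (Weyl integration formula), p. 184 (`⟨ , ⟩_e`); §12.6 p. 187 («By the Weyl integration formula, `Tr(π′(f_π)) = ⟨χ_{π′}, χ_π⟩_e`»).
-/

set_option autoImplicit false
-- the mandated namespace has the single-problem summit's repeated segment (`HodgeConjecture.HodgeConjecture`)
set_option linter.dupNamespace false

noncomputable section

open NumberField IsDedekindDomain MeasureTheory Filter Topology
open scoped Matrix MatrixGroups ComplexConjugate
open Literature.NumberTheory.Rogawski1990 Literature.NumberTheory.Automorphic Literature.NumberTheory.Automorphic.UnitaryGroup
open Literature.NumberTheory.Rogawski1990.Ch12Sec5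

namespace Summit.HodgeConjecture.HodgeConjecture.Cruxes.H413.F0P3cStCharTSPctOut

/-! ## §1 Generic carriers: `PseudoCoeffTrace` from the Weyl integration formula -/

section Generic

variable {G H' : Type} [Group G] [TopologicalSpace G] [IsTopologicalGroup G] [MeasurableSpace G] [BorelSpace G] [T2Space G]
  [∀ γ : G, MeasurableSpace (G ⧸ Subgroup.centralizer ({γ} : Set G))] [MeasurableSpace (G ⧸ Subgroup.center G)]
  [Group H'] [TopologicalSpace H'] [IsTopologicalGroup H'] [MeasurableSpace H']

omit [BorelSpace G] [T2Space G] in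
/-- On an ELLIPTIC Cartan representative `T` the Weyl integrand `D² Φ(·, f_π) χ_{π′}` of a pseudo-coefficient `f_π` is a.e. the elliptic-inner-product
integrand `D² χ_{π′} \overline{χ_π}` ((C2): a.e. `t ∈ G^e`, where `Φ(t, f_π) = \overline{χ_π(t)}`). [cite: Rogawski1990, §12.5 p. 184; §12.6 p. 187] -/
theorem weylIntegrand_ae_eq_of_mem_cartanG (𝔇 : EllipticData G H') (hC2 : 𝔇.EllCartanAE) {π : IrrClass G} {f : G → ℂ}
    (hf : 𝔇.IsPseudoCoeff π f) (α : G → ℂ) {T : Subgroup G} (hT : T ∈ 𝔇.cartanG) :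
    (fun t : ↥T => (𝔇.DG (t : G) : ℂ) ^ 2 * 𝔇.orbInt (t : G) f * α (t : G)) =ᵐ[𝔇.μT T]
      (fun t : ↥T => (𝔇.DG (t : G) : ℂ) ^ 2 * α (t : G) * conj (𝔇.char π (t : G))) := by
  filter_upwards [hC2 T hT] with t ht
  rw [hf.2.2 _ ht]
  ring

omit [BorelSpace G] [T2Space G] in
/-- On a NON-elliptic Cartan representative the Weyl integrand of a pseudo-coefficient VANISHES a.e. ((C3): a.e. `t ∈ G^r ∖ G^e`, where `Φ(t, f_π) = 0`).
[cite: Rogawski1990, §12.5 p. 182; §12.6 p. 187] -/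
theorem weylIntegrand_ae_eq_zero_of_not_mem_cartanG (𝔇 : EllipticData G H') (hC3 : 𝔇.NonEllCartanAE) {π : IrrClass G} {f : G → ℂ}
    (hf : 𝔇.IsPseudoCoeff π f) (α : G → ℂ) {T : Subgroup G} (hT : T ∈ 𝔇.cartanAll) (hT' : T ∉ 𝔇.cartanG) :
    (fun t : ↥T => (𝔇.DG (t : G) : ℂ) ^ 2 * 𝔇.orbInt (t : G) f * α (t : G)) =ᵐ[𝔇.μT T] 0 := by
  filter_upwards [hC3 T hT hT'] with t ht
  rw [hf.2.1 _ ⟨ht.1, ht.2⟩]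
  simp

omit [BorelSpace G] [T2Space G] in
/-- The elliptic-inner-product integrand `D² χ_{π′} \overline{χ_π}` is INTEGRABLE on an elliptic Cartan representative: (L2D∀) for `π′` and `π` +
Cauchy–Schwarz (`D` is real, so `D² χ_{π′} \overline{χ_π} = (Dχ_{π′}) · \overline{(Dχ_π)}`). [cite: Rogawski1990, §12.5 p. 184] -/
theorem integrable_innerIntegrand (𝔇 : EllipticData G H') (hL2 : 𝔇.L2CharOnTorusAll) (π π' : IrrClass G) {T : Subgroup G} (hT : T ∈ 𝔇.cartanG) :
    Integrable (fun t : ↥T => (𝔇.DG (t : G) : ℂ) ^ 2 * 𝔇.char π' (t : G) * conj (𝔇.char π (t : G))) (𝔇.μT T) := by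
  have h1 : MemLp (fun t : ↥T => (𝔇.DG (t : G) : ℂ) * 𝔇.char π' (t : G)) 2 (𝔇.μT T) := hL2 π' T hT
  have h2 : MemLp (fun t : ↥T => (𝔇.DG (t : G) : ℂ) * 𝔇.char π (t : G)) 2 (𝔇.μT T) := hL2 π T hT
  have h2' : MemLp (fun t : ↥T => conj ((𝔇.DG (t : G) : ℂ) * 𝔇.char π (t : G))) 2 (𝔇.μT T) :=
    h2.norm.mono' (Complex.continuous_conj.comp_aestronglyMeasurable h2.1) (Eventually.of_forall fun t =>
      (RCLike.norm_conj _).le)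
  refine (h1.integrable_mul h2').congr (Eventually.of_forall fun t => ?_)
  simp only [Pi.mul_apply, map_mul, Complex.conj_ofReal]
  ring

/-- **«By the Weyl integration formula, `Tr(π′(f_π)) = ⟨χ_{π′}, χ_π⟩_e`»** — generic carriers.  HYPOTHESES (all conjuncts of the (S-𝔇) package, (M1) read
for every class, plus the class-function property of the characters): WIF; for every `π′`: `χ_{π′}` measurable, locally integrable, representing `Tr π′` on
`C_c^∞(G)`, and a class function on `G^r`; (C1) `𝒞_G ⊆ 𝒞_all`; (C2); (C3); (L2D∀).  CONCLUSION: ★ `Ch12Sec6.PseudoCoeffTrace 𝔇`.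
[cite: Rogawski1990, §12.6 p. 187; §12.5 pp. 182, 184] -/
theorem pseudoCoeffTrace_of_weylIntegrationFormula (𝔇 : EllipticData G H') (hWIF : 𝔇.WeylIntegrationFormula)
    (hM1 : ∀ π : IrrClass G, Measurable (𝔇.char π) ∧ LocallyIntegrable (𝔇.char π) 𝔇.μG ∧
      ∀ φ : G → ℂ, IsLocSmooth φ → π.smoothTrace 𝔇.μG φ = ∫ x, φ x * 𝔇.char π x ∂𝔇.μG)
    (hcl : ∀ π : IrrClass G, IsClassFunOn 𝔇.regG (𝔇.char π))
    (hC1 : 𝔇.EllCartanSubset) (hC2 : 𝔇.EllCartanAE) (hC3 : 𝔇.NonEllCartanAE) (hL2 : 𝔇.L2CharOnTorusAll) :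
    Ch12Sec6.PseudoCoeffTrace 𝔇 := by
  intro π π' f hf
  obtain ⟨hmeas, hli, htr⟩ := hM1 π'
  have hfS : f ∈ SchwartzBruhat G := hf.1
  -- (1) the trace as an integral against `χ_{π′}`
  rw [htr f hfS]
  -- (2) the convergence hypotheses of the Weyl integration formula
  have hint : Integrable (fun g => f g * 𝔇.char π' g) 𝔇.μG := by
    have h := hli.integrable_smul_left_of_hasCompactSupport hfS.1.continuous hfS.2
    simpa only [smul_eq_mul] using h
  have hintT : ∀ T ∈ 𝔇.cartanAll,
      Integrable (fun t : ↥T => (𝔇.DG (t : G) : ℂ) ^ 2 * 𝔇.orbInt (t : G) f * 𝔇.char π' (t : G)) (𝔇.μT T) := by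
    intro T hT
    by_cases hTe : T ∈ 𝔇.cartanG
    · exact (integrable_innerIntegrand 𝔇 hL2 π π' hTe).congr (weylIntegrand_ae_eq_of_mem_cartanG 𝔇 hC2 hf _ hTe).symm
    · exact (integrable_zero _ _ _).congr (weylIntegrand_ae_eq_zero_of_not_mem_cartanG 𝔇 hC3 hf _ hT hTe).symm
  -- (3) the Weyl integration formula
  rw [hWIF f hfS (𝔇.char π') hmeas (hcl π') hint hintT]
  -- (4) split the sum over `𝒞_all` into `𝒞_G` and the rest, which vanishes
  rw [← Finset.sum_subset hC1 (fun T hT hTe => by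
    rw [integral_congr_ae (weylIntegrand_ae_eq_zero_of_not_mem_cartanG 𝔇 hC3 hf _ hT hTe)]
    simp)]
  -- (5) on the elliptic tori the integrand is the inner-product integrand
  refine Finset.sum_congr rfl fun T hT => ?_
  rw [integral_congr_ae (weylIntegrand_ae_eq_of_mem_cartanG 𝔇 hC2 hf _ hT)]

end Generic

/-! ## §2 `U(Φ₃)(L⁺_v)` at a non-split place: the class-function hypothesis discharged by ★ «CLASS-FN★» -/

section U3

variable (L : Type) [Field L] [NumberField L] [IsCMField L] (v : HeightOneSpectrum (𝓞 ↥(maximalRealSubfield L)))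

/-- **«PCT-OUT★» ON `U(Φ₃)(L⁺_v)`** (non-split `v`): at any §12.5 datum `𝔇` on `(U(Φ₃)(L⁺_v), H)` with the organ's Haar measure and regular set
(COMPAT), the carpet relation ★ `Ch12Sec6.PseudoCoeffTrace 𝔇` FOLLOWS from: (M1) for every class (the four clauses of ★ `CharRegularity` without the
square-integrability antecedent — paid at the concrete datum by ★ «CHAR-FIELD★»), the Weyl integration formula, (C1), (C2), (C3) and (L2D∀).  The
class-function property of `χ_{π′}` on `G^r` is supplied by ★ «CLASS-FN★» (every class of `U(Φ₃)(L⁺_v)` is admissible).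
[cite: Rogawski1990, §12.6 p. 187; §12.5 pp. 182, 184; §1.6 p. 5] -/
theorem pseudoCoeffTrace_Gqs (hns : ∀ w : PlacesOver L v, IsCMField.complexConj L • w.1 = w.1)
    [MeasurableSpace (Gqs L v)] [BorelSpace (Gqs L v)]
    [∀ γ : Gqs L v, MeasurableSpace (Gqs L v ⧸ Subgroup.centralizer ({γ} : Set (Gqs L v)))] [MeasurableSpace (Gqs L v ⧸ Subgroup.center (Gqs L v))]
    {H : Type} [Group H] [TopologicalSpace H] [IsTopologicalGroup H] [MeasurableSpace H]
    (νQv : Measure (Gqs L v)) [νQv.IsHaarMeasure] [νQv.IsMulRightInvariant]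
    (𝔇 : EllipticData (Gqs L v) H) (hμG : 𝔇.μG = νQv)
    (hreg : ∀ γ : Gqs L v, γ ∈ 𝔇.regG ↔ IsRegularElt (γ.val : GL (Fin 3) (UnitaryGroup.LocalRing L v)))
    (hM1 : ∀ π : IrrClass (Gqs L v), Measurable (𝔇.char π) ∧ LocallyIntegrable (𝔇.char π) 𝔇.μG ∧
      (∀ x ∈ 𝔇.regG, ∀ᶠ y in 𝓝 x, 𝔇.char π y = 𝔇.char π x) ∧
      ∀ φ : Gqs L v → ℂ, IsLocSmooth φ → π.smoothTrace 𝔇.μG φ = ∫ x, φ x * 𝔇.char π x ∂𝔇.μG)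
    (hWIF : 𝔇.WeylIntegrationFormula) (hC1 : 𝔇.EllCartanSubset) (hC2 : 𝔇.EllCartanAE) (hC3 : 𝔇.NonEllCartanAE) (hL2 : 𝔇.L2CharOnTorusAll) :
    Ch12Sec6.PseudoCoeffTrace 𝔇 := by
  haveI : TotallyDisconnectedSpace (Gqs L v) := totallyDisconnectedSpace_cmDatum_local L 3 (qsForm L) v
  have hregconj : ∀ γ ∈ 𝔇.regG, ∀ x : Gqs L v, x * γ * x⁻¹ ∈ 𝔇.regG := fun γ hγ x =>
    (hreg _).2 ((isRegularElt_iff_of_isConj_local L (qsForm L) v (b := γ) (b' := x * γ * x⁻¹) (isConj_iff.2 ⟨x, rfl⟩)).1 ((hreg γ).1 hγ))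
  have hcl : ∀ π : IrrClass (Gqs L v), IsClassFunOn 𝔇.regG (𝔇.char π) := by
    intro π
    obtain ⟨-, -, hlc, htr⟩ := hM1 π
    rw [hμG] at htr
    exact F0P3cStCharTSClassFn.isClassFunOn_of_locallyConstant_of_smoothTrace νQv hregconj hlc π
      (F0P3LocalIrrepAdmissibleOfCuspidal.isAdmissible_irrClass_quasiSplit_of_cuspidal L v
        (F0P3LocalIrrepAdmissibleThree.isSupercuspidal_of_subsingleton_coinvariants L v hns) π) htr
  exact pseudoCoeffTrace_of_weylIntegrationFormula 𝔇 hWIF (fun π => ⟨(hM1 π).1, (hM1 π).2.1, (hM1 π).2.2.2⟩) hcl hC1 hC2 hC3 hL2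

end U3

end Summit.HodgeConjecture.HodgeConjecture.Cruxes.H413.F0P3cStCharTSPctOut

end
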